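import Summits.AtomisticToContinuum.FouriersLaw.Theses.LocalOhmBV
import Summits.AtomisticToContinuum.FouriersLaw.Theorems.ParityLiouvilleSeedWindowLimitDefs
import Literature.MathematicalPhysics.KineticTheory.LangevinChainGibbs
import Summits.AtomisticToContinuum.FouriersLaw.Theorems.LocalOhmBVLocalOhmStubFiniteResponsePackageAux1
import Summits.AtomisticToContinuum.FouriersLaw.Theorems.LocalOhmBVLocalOhmStubFiniteResponsePackageAux2
import Summits.AtomisticToContinuum.FouriersLaw.Theorems.LocalOhmBVLocalOhmStubFiniteResponsePackageAux3
import Summits.AtomisticToContinuum.FouriersLaw.Theorems.LocalOhmBVLocalOhmStubFiniteResponsePackageAux4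
import Summits.AtomisticToContinuum.FouriersLaw.Theorems.BondHeatUncertaintyExtensiveSnapshotIrreversibilityNessGibbsLipschitz
import Summits.AtomisticToContinuum.FouriersLaw.Theorems.OddSectorIrreversibilityResponseDensityAssembly

/-!
# Stub `stub_finiteResponsePackage` (S2a) of the birth line of `LocalOhmBV.LocalOhm`

The finite-`N` NON-EQUILIBRIUM package of the extraction step of the birth line of crux
`Summit.AtomisticToContinuum.FouriersLaw.Theses.LocalOhmBV.LocalOhm` (item stmt-AtomisticToContinuum-12009):
for the pinned anharmonic chain `P = pinnedChain ω₂ lam β γ` (all parameters `> 0`), under uniqueness of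
the weak steady states, along a steady-state family `μ N T_L T_R`, for `T > 0` and every `N ≥ 3`:

* (a1) `μ N T T` is the Gibbs state (`steadyFamily_eq_gibbsMeasure`, helper file Aux1);
* (a2) `steadyFamily_exists_responseLimit` — the first-order response limit
  `lim_{δ → 0, δ ≠ 0} (μ_{N,T+δ/2,T-δ/2}(ψ) - μ_{N,T,T}(ψ))/δ` EXISTS for every continuous polynomially
  bounded observable `ψ`. The tree has it for `C²` observables dominated by `e^{ϑH}`
  (`pinnedChain_linear_response_of_uniformMixing` with the `δ`-uniform mixing constants
  `Corrector.pinnedChain_uniformMixing`, the kernel continuity `pinnedChain_tendsto_integral_kernel_temps`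
  and the identification `steadyFamily_isInvariant`); the upgrade: `ψ` is, for every `ε`, within
  `ε e^{θH}` of a smooth compactly supported `φ` (Aux2), the `O(δ)`-closeness of the NESS to the Gibbs
  state on `C²` observables (`LogDensity.ness_gibbs_integral_sub_le`) extends to continuous ones (Aux2),
  so the difference quotients of `ψ` are eventually `Kε`-close to those of `φ`, which converge — Cauchy
  criterion (`exists_tendsto_of_forall_approx`);
* (a3) `integral_liouvilleZ_embed_eq_zero_of_contDiff_one`, `steadyFamily_integral_liouvilleZ_embed_eq_zero`
  — weak stationarity of the transported Liouville derivative of `C¹` polynomially bounded cylinders read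
  in the bulk: the smooth case (Aux4) plus mollification with polynomial bounds (Aux3) and dominated
  convergence; moments of the steady states from `BondHeatUncertainty.ness_facts`;
* (a4) equal mean bond currents on all genuine bonds (`steadyFamily_integral_bondCurrent_eq`, Aux1).

No definitions.
-/

set_option autoImplicit false

noncomputable section

namespace Summit.AtomisticToContinuum.FouriersLaw.Theorems.LocalOhmBirth

open MeasureTheory Filter Topology
open scoped BigOperators NNReal ContDiff
open Literature.MathematicalPhysics.KineticTheory.HeatConduction
open Summit.AtomisticToContinuum.FouriersLaw.Theorems.WindowLimit (embed norm_boxRestrictAt_embed_le)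

/-! ## (a2) Response limits of continuous polynomially bounded observables -/

/-- **(a2): existence of the first-order response limit for continuous polynomially bounded
observables.** For the pinned chain (all parameters `> 0`), under weak-NESS uniqueness, along a
steady-state family `μ`, for `T > 0`, `N ≥ 2` and every continuous `ψ` with `|ψ z| ≤ C₀ (1 + ‖z‖)^m`, the
limit `lim_{δ → 0, δ ≠ 0} (∫ ψ dμ_{N,T+δ/2,T-δ/2} - ∫ ψ dμ_{N,T,T})/δ` exists (smooth weighted
approximation, `O(δ)`-closeness of the NESS to Gibbs on continuous observables, linear response of `C²`
observables, Cauchy criterion). [cite: CuneoEckmannHairerReyBellet2018, Thm 2.13 (3)] -/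
theorem steadyFamily_exists_responseLimit {ω₂ lam β γ : ℝ} (hω : 0 < ω₂) (hl : 0 < lam) (hβ : 0 < β)
    (hγ : 0 < γ)
    (hU : ∀ (N : ℕ) (T_L T_R : ℝ), 0 < T_L → 0 < T_R → ∀ μ ν : Measure (PhaseSpace N),
      (pinnedChain ω₂ lam β γ).IsSteadyState N T_L T_R μ →
      (pinnedChain ω₂ lam β γ).IsSteadyState N T_L T_R ν → μ = ν)
    (μ : (N : ℕ) → ℝ → ℝ → Measure (PhaseSpace N))
    (hμ : ∀ (N : ℕ) (T_L T_R : ℝ), 0 < T_L → 0 < T_R →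
      (pinnedChain ω₂ lam β γ).IsSteadyState N T_L T_R (μ N T_L T_R))
    {T : ℝ} (hT : 0 < T) {N : ℕ} (hN : 2 ≤ N) {ψ : PhaseSpace N → ℝ} (hψ : Continuous ψ)
    (hψb : ∃ (C₀ : ℝ) (m : ℕ), ∀ z, |ψ z| ≤ C₀ * (1 + ‖z‖) ^ m) :
    ∃ ρ : ℝ, Tendsto (fun δ : ℝ => ((∫ z, ψ z ∂(μ N (T + δ / 2) (T - δ / 2))) -
      ∫ z, ψ z ∂(μ N T T)) / δ) (𝓝[≠] 0) (𝓝 ρ) := by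
  obtain ⟨C₀, m, hψC⟩ := hψb
  set P := pinnedChain ω₂ lam β γ with hP
  have hN0 : 0 < N := by omega
  -- (a1): the equilibrium member is the Gibbs state
  have hTT : μ N T T = P.gibbsMeasure N T :=
    steadyFamily_eq_gibbsMeasure hω hl.le hβ.le hT (hU N T T hT hT) (hμ N T T hT hT)
  -- `δ`-uniform mixing constants and the `C²` Lipschitz estimate
  obtain ⟨δ₀, ϑ, Cm, c, hδ₀, hδ₀T, hϑ, hϑT, h2ϑ, hCm, hc, hUM⟩ :=
    OddSectorIrreversibility.Corrector.pinnedChain_uniformMixing (N := N) hω hl.le hβ hγ hN0 hT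
  obtain ⟨δ₁, ϑ₁, K, hδ₁, -, hϑ₁, hK, hLip⟩ :=
    ExtensiveSnapshotIrreversibility.ClausiusBudget.LogDensity.ness_gibbs_integral_sub_le ω₂ lam β γ
      hω hl hβ hγ μ hμ T hT N hN0
  -- the common weight `w = e^{θH}`, `θ = min ϑ ϑ₁`
  set θ : ℝ := min ϑ ϑ₁ with hθ
  have hθ0 : 0 < θ := lt_min hϑ hϑ₁
  have hθϑ : θ ≤ ϑ := min_le_left _ _
  have hθϑ₁ : θ ≤ ϑ₁ := min_le_right _ _
  have hHnn : ∀ z : PhaseSpace N, 0 ≤ P.hamiltonian N z := fun z =>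
    pinnedChain_hamiltonian_nonneg hω.le hl.le hβ.le γ N z
  set w : PhaseSpace N → ℝ := fun z => Real.exp (θ * P.hamiltonian N z) with hw
  have hw1 : ∀ z, 1 ≤ w z := fun z => Real.one_le_exp (mul_nonneg hθ0.le (hHnn z))
  have hwϑ : ∀ z, w z ≤ Real.exp (ϑ * P.hamiltonian N z) := fun z =>
    Real.exp_le_exp.2 (mul_le_mul_of_nonneg_right hθϑ (hHnn z))
  have hwϑ₁ : ∀ z, w z ≤ Real.exp (ϑ₁ * P.hamiltonian N z) := fun z =>
    Real.exp_le_exp.2 (mul_le_mul_of_nonneg_right hθϑ₁ (hHnn z))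
  -- polynomial weights against `w`
  obtain ⟨A, hA0, hA⟩ := one_add_norm_pow_le_exp_hamiltonian hω hl.le hβ.le γ N hθ0 (m + 1)
  have hAm : ∀ z : PhaseSpace N, (1 + ‖z‖) ^ m ≤ A * w z := fun z =>
    (pow_le_pow_right₀ (le_add_of_nonneg_right (norm_nonneg _)) (Nat.le_succ m)).trans (hA z)
  -- the steady family is the invariant probability family of the kernels
  have hident := fun (T_L T_R : ℝ) (hL : 0 < T_L) (hR : 0 < T_R) =>
    steadyFamily_isInvariant hω hl.le hβ hγ hN0 (hU N) (μ N) (hμ N) hL hR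
  -- response limits of `C²` observables dominated by `e^{ϑH}`
  have key : ∀ (φ : PhaseSpace N → ℝ) (C : ℝ), ContDiff ℝ 2 φ →
      (∀ y, |φ y| ≤ C * Real.exp (ϑ * P.hamiltonian N y)) →
      ∃ ρ : ℝ, Tendsto (fun δ : ℝ => ((∫ x, φ x ∂(μ N (T + δ / 2) (T - δ / 2))) -
        ∫ x, φ x ∂(μ N T T)) / δ) (𝓝[≠] 0) (𝓝 ρ) := by
    intro φ C hφ2 hφ
    have hμP : ∀ δ : ℝ, |δ| < δ₀ → IsProbabilityMeasure (μ N (T + δ / 2) (T - δ / 2)) := fun δ hδ =>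
      (hident _ _ (bath_facts_of_abs_lt hδ₀T hϑT hδ).1 (bath_facts_of_abs_lt hδ₀T hϑT hδ).2.1).1
    have hμI : ∀ δ : ℝ, |δ| < δ₀ → ∀ t : ℝ≥0, (μ N (T + δ / 2) (T - δ / 2)).bind
        (P.transitionKernel N (T + δ / 2) (T - δ / 2) t) = μ N (T + δ / 2) (T - δ / 2) := fun δ hδ =>
      (hident _ _ (bath_facts_of_abs_lt hδ₀T hϑT hδ).1 (bath_facts_of_abs_lt hδ₀T hϑT hδ).2.1).2
    have hlr := pinnedChain_linear_response_of_uniformMixing hω hl.le hβ hγ hN0 hT hδ₀ hδ₀T hϑ hϑT hφ2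
      hφ hCm hc hUM (pinnedChain_tendsto_integral_kernel_temps hω hl.le hβ.le hγ hN0 hT hϑ h2ϑ
        hφ2.continuous hφ) (fun δ => μ N (T + δ / 2) (T - δ / 2)) hμP hμI
    simp only [zero_div, add_zero, sub_zero] at hlr
    exact ⟨_, hlr⟩
  -- exponential moments of the Gibbs state and of the steady states
  have hθT : θ < 1 / T := by
    have : ϑ < 1 / T := by linarith
    exact hθϑ.trans_lt this
  have hwG : Integrable w (P.gibbsMeasure N T) :=
    pinnedChain_integrable_exp_mul_hamiltonian_gibbsMeasure hω hl.le hβ.le γ N hT hθT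
  have hwN : ∀ δ : ℝ, |δ| < δ₀ → Integrable w (μ N (T + δ / 2) (T - δ / 2)) := by
    intro δ hδ
    obtain ⟨hL, hR, hϑ'⟩ := bath_facts_of_abs_lt hδ₀T hϑT hδ
    obtain ⟨-, -, hint, -⟩ := BondHeatUncertainty.ness_facts ω₂ lam β γ hω hl hβ hγ hU μ hμ N hN _ _ hL hR
    exact hint θ hθ0 (hθϑ.trans_lt hϑ')
  -- integrability of `ψ`
  have hψw : ∀ z, |ψ z| ≤ (max C₀ 0 * A) * w z := fun z => by
    calc |ψ z| ≤ C₀ * (1 + ‖z‖) ^ m := hψC z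
      _ ≤ max C₀ 0 * (1 + ‖z‖) ^ m := mul_le_mul_of_nonneg_right (le_max_left _ _) (by positivity)
      _ ≤ max C₀ 0 * (A * w z) := mul_le_mul_of_nonneg_left (hAm z) (le_max_right _ _)
      _ = _ := by ring
  have hψi : ∀ {ν : Measure (PhaseSpace N)}, Integrable w ν → Integrable ψ ν := fun hν =>
    (hν.const_mul (max C₀ 0 * A)).mono' hψ.aestronglyMeasurable (Eventually.of_forall fun z => by
      rw [Real.norm_eq_abs]; exact hψw z)
  -- the Cauchy argument
  refine exists_tendsto_of_forall_approx fun ε hε => ?_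
  set ε' : ℝ := ε / (K + 1) with hε'
  have hε'0 : 0 < ε' := by positivity
  have hε'K : K * ε' ≤ ε := by
    rw [hε', mul_div_assoc', div_le_iff₀ (by positivity)]
    nlinarith
  obtain ⟨φ, hφs, hφcs, hφε⟩ := exists_smooth_compactSupport_approx_of_weight hψ hw1
    (fun η hη => far_decay_of_polyBound hψC hA0 hA hη) hε'0
  have hφ2 : ContDiff ℝ 2 φ := hφs.of_le (by norm_cast)
  have hφc : Continuous φ := hφs.continuous
  obtain ⟨Bφ, hBφ⟩ := hφc.bounded_above_of_compact_support hφcs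
  have hB0 : 0 ≤ max Bφ 0 := le_max_right _ _
  have hφB : ∀ y, |φ y| ≤ max Bφ 0 := fun y => (Real.norm_eq_abs (φ y) ▸ hBφ y).trans (le_max_left _ _)
  have hφdom : ∀ y, |φ y| ≤ max Bφ 0 * Real.exp (ϑ * P.hamiltonian N y) := fun y => by
    calc |φ y| ≤ max Bφ 0 * 1 := by rw [mul_one]; exact hφB y
      _ ≤ max Bφ 0 * Real.exp (ϑ * P.hamiltonian N y) :=
          mul_le_mul_of_nonneg_left (Real.one_le_exp (mul_nonneg hϑ.le (hHnn y))) hB0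
  obtain ⟨ρφ, hρφ⟩ := key φ (max Bφ 0) hφ2 hφdom
  refine ⟨fun δ => ((∫ x, φ x ∂(μ N (T + δ / 2) (T - δ / 2))) - ∫ x, φ x ∂(μ N T T)) / δ,
    ⟨ρφ, hρφ⟩, ?_⟩
  -- the difference `ψ - φ` is continuous, polynomially bounded and `ε' w`-small
  have hgc : Continuous fun z => ψ z - φ z := hψ.sub hφc
  have hgpoly : ∀ z, |ψ z - φ z| ≤ (C₀ + max Bφ 0) * (1 + ‖z‖) ^ m := fun z => by
    have h1 : (1 : ℝ) ≤ (1 + ‖z‖) ^ m := one_le_pow₀ (le_add_of_nonneg_right (norm_nonneg _))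
    calc |ψ z - φ z| ≤ |ψ z| + |φ z| := abs_sub _ _
      _ ≤ C₀ * (1 + ‖z‖) ^ m + max Bφ 0 * (1 + ‖z‖) ^ m :=
          add_le_add (hψC z) (by nlinarith [hφB z])
      _ = _ := by ring
  have hφi : ∀ {ν : Measure (PhaseSpace N)}, Integrable w ν → Integrable φ ν := fun hν =>
    (hν.const_mul (max Bφ 0)).mono' hφc.aestronglyMeasurable (Eventually.of_forall fun z => by
      rw [Real.norm_eq_abs]
      calc |φ z| ≤ max Bφ 0 * 1 := by rw [mul_one]; exact hφB z
        _ ≤ max Bφ 0 * w z := mul_le_mul_of_nonneg_left (hw1 z) hB0)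
  have hev : ∀ᶠ δ in 𝓝[≠] (0 : ℝ), δ ≠ 0 ∧ |δ| < min δ₀ δ₁ := by
    have h1 : ∀ᶠ δ in 𝓝[≠] (0 : ℝ), δ ≠ 0 := eventually_mem_nhdsWithin
    have h2 : ∀ᶠ δ in 𝓝 (0 : ℝ), |δ| < min δ₀ δ₁ := by
      have h := eventually_abs_sub_lt (0 : ℝ) (lt_min hδ₀ hδ₁)
      simpa only [sub_zero] using h
    exact h1.and (h2.filter_mono nhdsWithin_le_nhds)
  filter_upwards [hev] with δ hδ
  obtain ⟨hδ0, hδm⟩ := hδ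
  have hδ₀' : |δ| < δ₀ := hδm.trans_le (min_le_left _ _)
  have hδ₁' : |δ| < δ₁ := hδm.trans_le (min_le_right _ _)
  set ν := μ N (T + δ / 2) (T - δ / 2) with hν
  -- `O(δ)`-closeness on the continuous observable `ψ - φ`
  have hC2 : ∀ φ' : PhaseSpace N → ℝ, ContDiff ℝ 2 φ' → (∀ z, |φ' z| ≤ w z) →
      |(∫ z, φ' z ∂ν) - ∫ z, φ' z ∂(P.gibbsMeasure N T)| ≤ K * |δ| := fun φ' hφ' hφ'w =>
    hLip δ hδ₁' φ' hφ' fun z => (hφ'w z).trans (hwϑ₁ z)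
  have hclose := abs_integral_sub_le_of_contDiff_two hw1 (hwN δ hδ₀') hwG (by positivity) hC2 hgc
    (fun η hη => far_decay_of_polyBound hgpoly hA0 hA hη) hε'0.le hφε
  -- conclusion
  have hdiff : ((∫ z, ψ z ∂ν) - ∫ z, ψ z ∂(μ N T T)) / δ -
      ((∫ x, φ x ∂ν) - ∫ x, φ x ∂(μ N T T)) / δ =
      ((∫ z, (ψ z - φ z) ∂ν) - ∫ z, (ψ z - φ z) ∂(P.gibbsMeasure N T)) / δ := by
    rw [hTT, integral_sub (hψi (hwN δ hδ₀')) (hφi (hwN δ hδ₀')), integral_sub (hψi hwG) (hφi hwG)]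
    ring
  rw [hdiff, abs_div]
  calc |(∫ z, (ψ z - φ z) ∂ν) - ∫ z, (ψ z - φ z) ∂(P.gibbsMeasure N T)| / |δ|
      ≤ K * |δ| * ε' / |δ| := div_le_div_of_nonneg_right hclose (abs_nonneg _)
    _ = K * ε' := by field_simp [abs_ne_zero.2 hδ0]
    _ ≤ ε := hε'K

/-! ## (a3) Weak stationarity of transported Liouville derivatives -/

/-- **The `C¹` case (clause (a3) of S2a, measure-level form)**: for a `C¹` profile `G` with
`|G|, ‖DG‖ ≤ C₀ (1 + ‖y‖)^m` on a box read at the finite sites `a + c, …, a + c + n ∈ [1, N - 2]`, and a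
finite measure `μ` weakly stationary on `C_c^∞` with all polynomial moments, the transported Liouville
derivative `x ↦ 𝒜(G ∘ box)(embed N c x)` is `μ`-integrable with integral `0` (smooth approximation with
the same polynomial growth and convergent gradients, dominated convergence). [folklore] -/
theorem integral_liouvilleZ_embed_eq_zero_of_contDiff_one (ω₂ lam β γ T_L T_R : ℝ) {a : ℤ} {n N c : ℕ}
    (hc : 1 ≤ a + c) (hN : a + c + n + 2 ≤ N) (μ : Measure (PhaseSpace N)) [IsFiniteMeasure μ]
    (hweak : ∀ f : PhaseSpace N → ℝ, ContDiff ℝ ∞ f → HasCompactSupport f →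
      ∫ x, (pinnedChain ω₂ lam β γ).generator N T_L T_R f x ∂μ = 0)
    (hmom : ∀ K : ℕ, Integrable (fun x : PhaseSpace N => (1 + ‖x‖) ^ K) μ)
    {G : (Fin (n + 1) → ℝ × ℝ) → ℝ} (hG : ContDiff ℝ 1 G) {C₀ : ℝ} {m : ℕ} (hGb : ∀ y, |G y| ≤ C₀ * (1 + ‖y‖) ^ m)
    (hDb : ∀ y, ‖fderiv ℝ G y‖ ≤ C₀ * (1 + ‖y‖) ^ m) :
    Integrable (fun x => liouvilleZ (pinnedChain ω₂ lam β γ) (G ∘ boxRestrictAt a n) (embed N c x)) μ ∧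
      ∫ x, liouvilleZ (pinnedChain ω₂ lam β γ) (G ∘ boxRestrictAt a n) (embed N c x) ∂μ = 0 := by
  set P := pinnedChain ω₂ lam β γ with hP
  have hC₀ : 0 ≤ C₀ := by
    have h := (abs_nonneg _).trans (hGb 0)
    exact nonneg_of_mul_nonneg_left h (by positivity)
  have h0c : (0 : ℤ) ≤ a + c := by omega
  have hNc : a + c + n < N := by omega
  have hGd : Differentiable ℝ G := hG.differentiable one_ne_zero
  obtain ⟨gs, hgs, hgsb, hgsD, -, hgslim⟩ := exists_smooth_approx_of_contDiff_one_polyBound hG hGb hDb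
  have hgsd : ∀ j, Differentiable ℝ (gs j) := fun j => (hgs j).differentiable (by simp)
  -- the common dominating function
  set Kn : ℝ := ((n : ℝ) + 1) * (1 + 4 * (|ω₂| + |lam| + 4 + 8 * |β|)) with hKn
  have hKn0 : 0 ≤ Kn := by rw [hKn]; positivity
  set bound : PhaseSpace N → ℝ := fun x => (2 ^ m * C₀ * Kn) * (1 + ‖x‖) ^ (m + 3) with hbound
  have hbint : Integrable bound μ := (hmom (m + 3)).const_mul _
  have hbox : ∀ x : PhaseSpace N, (1 + ‖boxRestrictAt a n (embed N c x)‖) ^ m ≤ (1 + ‖x‖) ^ m := fun x =>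
    pow_le_pow_left₀ (by positivity) (add_le_add le_rfl (norm_boxRestrictAt_embed_le h0c hNc x)) m
  have hdom : ∀ (g : (Fin (n + 1) → ℝ × ℝ) → ℝ) (x : PhaseSpace N), Differentiable ℝ g →
      (∀ y, ‖fderiv ℝ g y‖ ≤ 2 ^ m * C₀ * (1 + ‖y‖) ^ m) →
      |liouvilleZ P (g ∘ boxRestrictAt a n) (embed N c x)| ≤ bound x := by
    intro g x hgd hgD
    calc _ ≤ ‖fderiv ℝ g (boxRestrictAt a n (embed N c x))‖ * (Kn * (1 + ‖x‖) ^ 3) :=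
          abs_liouvilleZ_comp_boxRestrictAt_embed_le ω₂ lam β γ x (hgd _)
      _ ≤ (2 ^ m * C₀ * (1 + ‖x‖) ^ m) * (Kn * (1 + ‖x‖) ^ 3) :=
          mul_le_mul_of_nonneg_right ((hgD _).trans (mul_le_mul_of_nonneg_left (hbox x) (by positivity)))
            (by positivity)
      _ = bound x := by rw [hbound]; ring
  have hDb' : ∀ y, ‖fderiv ℝ G y‖ ≤ 2 ^ m * C₀ * (1 + ‖y‖) ^ m := fun y =>
    (hDb y).trans (by
      have : C₀ * (1 + ‖y‖) ^ m ≤ 2 ^ m * (C₀ * (1 + ‖y‖) ^ m) :=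
        le_mul_of_one_le_left (by positivity) (one_le_pow₀ (by norm_num))
      linarith)
  -- integrability of the limit
  have hcont := continuous_liouvilleZ_comp_boxRestrictAt_embed ω₂ lam β γ (a := a) (N := N) (c := c) hG
  have hint : Integrable (fun x => liouvilleZ P (G ∘ boxRestrictAt a n) (embed N c x)) μ :=
    hbint.mono' hcont.aestronglyMeasurable (Eventually.of_forall fun x => by
      rw [Real.norm_eq_abs]; exact hdom G x hGd hDb')
  refine ⟨hint, ?_⟩
  -- dominated convergence
  have hlim : Tendsto (fun j => ∫ x, liouvilleZ P (gs j ∘ boxRestrictAt a n) (embed N c x) ∂μ) atTop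
      (𝓝 (∫ x, liouvilleZ P (G ∘ boxRestrictAt a n) (embed N c x) ∂μ)) := by
    refine tendsto_integral_of_dominated_convergence bound
      (fun j => (continuous_liouvilleZ_comp_boxRestrictAt_embed ω₂ lam β γ
        ((hgs j).of_le (by norm_cast))).aestronglyMeasurable)
      hbint (fun j => Eventually.of_forall fun x => ?_) (Eventually.of_forall fun x => ?_)
    · rw [Real.norm_eq_abs]; exact hdom (gs j) x (hgsd j) (hgsD j)
    · exact tendsto_liouvilleZ_comp_boxRestrictAt_embed ω₂ lam β γ hGd hgsd hgslim x
  have hzero : ∀ j, ∫ x, liouvilleZ P (gs j ∘ boxRestrictAt a n) (embed N c x) ∂μ = 0 := fun j =>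
    integral_liouvilleZ_embed_eq_zero_of_smooth ω₂ lam β γ T_L T_R a n N c hc hN μ inferInstance hweak hmom
      (gs j) (hgs j) _ m (hgsb j) (hgsD j)
  simp only [hzero] at hlim
  exact tendsto_nhds_unique hlim tendsto_const_nhds ▸ rfl



/-- **(a3) along a steady-state family**: for the pinned chain (all parameters `> 0`), under weak-NESS
uniqueness, along a steady-state family `μ`, for `N ≥ 2`, all bath temperatures `T_L, T_R > 0`, a box
`{a, …, a + n}` read at the finite sites `a + c, …, a + c + n ∈ [1, N - 2]` and a `C¹` profile `G` with
`|G|, ‖DG‖ ≤ C₀ (1 + ‖y‖)^m`: the transported Liouville derivative `x ↦ 𝒜(G ∘ box)(embed N c x)` is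
integrable with integral `0` against `μ N T_L T_R` (Aux3 with the polynomial moments of the steady state,
`BondHeatUncertainty.ness_facts`). [folklore] -/
theorem steadyFamily_integral_liouvilleZ_embed_eq_zero {ω₂ lam β γ : ℝ} (hω : 0 < ω₂) (hl : 0 < lam)
    (hβ : 0 < β) (hγ : 0 < γ)
    (hU : ∀ (N : ℕ) (T_L T_R : ℝ), 0 < T_L → 0 < T_R → ∀ μ ν : Measure (PhaseSpace N),
      (pinnedChain ω₂ lam β γ).IsSteadyState N T_L T_R μ →
      (pinnedChain ω₂ lam β γ).IsSteadyState N T_L T_R ν → μ = ν)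
    (μ : (N : ℕ) → ℝ → ℝ → Measure (PhaseSpace N))
    (hμ : ∀ (N : ℕ) (T_L T_R : ℝ), 0 < T_L → 0 < T_R →
      (pinnedChain ω₂ lam β γ).IsSteadyState N T_L T_R (μ N T_L T_R))
    {N : ℕ} (hN : 2 ≤ N) {T_L T_R : ℝ} (hL : 0 < T_L) (hR : 0 < T_R) {a : ℤ} {n c : ℕ}
    (hc : 1 ≤ a + c) (hNb : a + c + n + 2 ≤ N) {G : (Fin (n + 1) → ℝ × ℝ) → ℝ} (hG : ContDiff ℝ 1 G)
    (hGb : ∃ (C₀ : ℝ) (m : ℕ), ∀ y, |G y| ≤ C₀ * (1 + ‖y‖) ^ m ∧ ‖fderiv ℝ G y‖ ≤ C₀ * (1 + ‖y‖) ^ m) :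
    Integrable (fun z => liouvilleZ (pinnedChain ω₂ lam β γ) (G ∘ boxRestrictAt a n) (embed N c z))
        (μ N T_L T_R) ∧
      ∫ z, liouvilleZ (pinnedChain ω₂ lam β γ) (G ∘ boxRestrictAt a n) (embed N c z) ∂(μ N T_L T_R) =
        0 := by
  obtain ⟨C₀, m, hb⟩ := hGb
  obtain ⟨hprob, -, hint, -⟩ :=
    BondHeatUncertainty.ness_facts ω₂ lam β γ hω hl hβ hγ hU μ hμ N hN T_L T_R hL hR
  have hmax : 0 < max T_L T_R := lt_max_of_lt_left hL
  have hϑ0 : 0 < 1 / max T_L T_R / 2 := by positivity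
  have hϑ1 : 1 / max T_L T_R / 2 < 1 / max T_L T_R := half_lt_self (by positivity)
  have hmom := fun K : ℕ =>
    integrable_one_add_norm_pow_of_exp hω hl.le hβ.le γ hϑ0 (hint _ hϑ0 hϑ1) K
  exact integral_liouvilleZ_embed_eq_zero_of_contDiff_one ω₂ lam β γ T_L T_R hc hNb (μ N T_L T_R)
    (hμ N T_L T_R hL hR).2.1 hmom hG (fun y => (hb y).1) (fun y => (hb y).2)

/-! ## The stub -/

/-- **S2a `stub_finiteResponsePackage`** (finite-`N` NON-EQUILIBRIUM package of the extraction step of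
the birth line of `LocalOhm`). In the frame of `LocalOhm` (pinned chain, all parameters `> 0`, weak-NESS
uniqueness, a steady-state family `μ`, `T > 0`), for every `N ≥ 3`: (a1) the family member at equal
temperatures is the Gibbs state; (a2) the first-order response limit exists for every continuous
polynomially bounded observable; (a3) weak stationarity holds for the transported Liouville derivative
of every `C¹` polynomially bounded cylinder observable read in the bulk, at all bath temperatures;
(a4) all genuine bond currents of a steady state have the same mean. Assembly of
`steadyFamily_eq_gibbsMeasure`, `steadyFamily_exists_responseLimit`,
`steadyFamily_integral_liouvilleZ_embed_eq_zero`, `steadyFamily_integral_bondCurrent_eq`.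
[cite: CuneoEckmannHairerReyBellet2018, Thm 2.13] -/
theorem stub_finiteResponsePackage :
    ∀ ω₂ lam β γ : ℝ, 0 < ω₂ → 0 < lam → 0 < β → 0 < γ →
    (∀ (N : ℕ) (T_L T_R : ℝ), 0 < T_L → 0 < T_R → ∀ μ ν : Measure (PhaseSpace N),
      (pinnedChain ω₂ lam β γ).IsSteadyState N T_L T_R μ →
      (pinnedChain ω₂ lam β γ).IsSteadyState N T_L T_R ν → μ = ν) →
    ∀ μ : (N : ℕ) → ℝ → ℝ → Measure (PhaseSpace N),
    (∀ (N : ℕ) (T_L T_R : ℝ), 0 < T_L → 0 < T_R →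
      (pinnedChain ω₂ lam β γ).IsSteadyState N T_L T_R (μ N T_L T_R)) →
    ∀ T : ℝ, 0 < T →
    ∀ N : ℕ, 3 ≤ N →
      μ N T T = (pinnedChain ω₂ lam β γ).gibbsMeasure N T ∧
      (∀ ψ : PhaseSpace N → ℝ, Continuous ψ →
        (∃ (C₀ : ℝ) (m : ℕ), ∀ z, |ψ z| ≤ C₀ * (1 + ‖z‖) ^ m) →
        ∃ ρ : ℝ, Tendsto (fun δ : ℝ => ((∫ z, ψ z ∂(μ N (T + δ / 2) (T - δ / 2))) -
          ∫ z, ψ z ∂(μ N T T)) / δ) (𝓝[≠] 0) (𝓝 ρ)) ∧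
      (∀ (T_L T_R : ℝ), 0 < T_L → 0 < T_R → ∀ (a : ℤ) (n c : ℕ), 1 ≤ a + c → a + c + n + 2 ≤ N →
        ∀ G : (Fin (n + 1) → ℝ × ℝ) → ℝ, ContDiff ℝ 1 G →
        (∃ (C₀ : ℝ) (m : ℕ), ∀ y, |G y| ≤ C₀ * (1 + ‖y‖) ^ m ∧ ‖fderiv ℝ G y‖ ≤ C₀ * (1 + ‖y‖) ^ m) →
        Integrable (fun z => liouvilleZ (pinnedChain ω₂ lam β γ) (G ∘ boxRestrictAt a n) (embed N c z))
            (μ N T_L T_R) ∧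
          ∫ z, liouvilleZ (pinnedChain ω₂ lam β γ) (G ∘ boxRestrictAt a n) (embed N c z) ∂(μ N T_L T_R) =
            0) ∧
      (∀ (T_L T_R : ℝ), 0 < T_L → 0 < T_R → ∀ i k : Fin N, i.val + 2 ≤ N → k.val + 2 ≤ N →
        ∫ z, (pinnedChain ω₂ lam β γ).bondCurrent N i z ∂(μ N T_L T_R) =
          ∫ z, (pinnedChain ω₂ lam β γ).bondCurrent N k z ∂(μ N T_L T_R)) := by
  intro ω₂ lam β γ hω hl hβ hγ hU μ hμ T hT N hN
  have hN2 : 2 ≤ N := by omega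
  refine ⟨steadyFamily_eq_gibbsMeasure hω hl.le hβ.le hT (hU N T T hT hT) (hμ N T T hT hT),
    fun ψ hψ hψb => steadyFamily_exists_responseLimit hω hl hβ hγ hU μ hμ hT hN2 hψ hψb,
    fun T_L T_R hL hR a n c hc hNb G hG hGb =>
      steadyFamily_integral_liouvilleZ_embed_eq_zero hω hl hβ hγ hU μ hμ hN2 hL hR hc hNb hG hGb,
    fun T_L T_R hL hR i k hi hk =>
      steadyFamily_integral_bondCurrent_eq ω₂ lam β γ hω hl hβ hγ hU μ hμ N hN2 T_L T_R hL hR i k hi hk⟩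

end Summit.AtomisticToContinuum.FouriersLaw.Theorems.LocalOhmBirth

end
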